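import Summits.MatrixMultiplication.OmegaCensus.STPPVosperClash225Tools

/-!
# ω-census (abelian STPP census): tools for the Vosper clash in `ℤ₆₁` — positions, the prefix law of disjoint 4-runs, and the finite check (kernel)

HONEST FRAMING (pub-omega census; verbatim): lottery ticket; floor = certified bounds/negative ranges.
Census STRUCTURE tools (seat pub-omega-stpp-1 gen 29, 2026-08-28), family (b2); nothing here is progress on `ω`.  Customer:
`STPPVosperClash235244.lean` (the beating pattern `{(2,3,5),(2,4,4)}`, `Σ abc = 62 > 61`, has no STPP family in `ℤ₆₁`; paper HOME
`pub-omega-stpp-1-g28/VOSPER-CLASH-235-244-Z61.md`).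

After the affine transport of `STPPVosperClash225Tools` (`x ↦ e′⁻¹(x − v)`), the Vosper structure of that pattern lives in the window
`{0,…,47} ⊆ ℤ₆₁` (`apFinset 0 1 48`): a 32-set `T` that is a DISJOINT union of eight 4-runs `{m, m+1, m+2, m+3}`, and its complement in the
window, a 16-term progression `S = {t + i•j : i < 16}`.  This file supplies:

* positions: `x ∈ apFinset 0 1 n ↔ x.val < n` and `(t + i•j).val = (t.val + j.val·i) mod 61`;
* **the prefix law** (`four_dvd_card_filter_val_lt`): if `x ∉ T` then `4 ∣ #{y ∈ T : y.val < x.val}` — every 4-run lies entirely below `x` or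
  entirely at/above it (a run straddling `x` would contain `x`); this is the exact form of «every maximal run of `T` has length `≡ 0 (mod 4)`»;
* the complement count `#{y ∈ T : y.val < x.val} = x.val − #{y ∈ S : y.val < x.val}` for `T ⊔ S =` the window and `x.val ≤ 48`;
* **the finite check** (`step3_nat`): over ALL `j, t < 61`, if the sixteen positions `(t + j·i) mod 61` lie in `[0,48)` and the prefix law holds
  at each of them, then `j ∈ {0, 1, 60}` — ONE `decide +kernel` on `ℕ` (≈ 8 s on the farm; the same statement phrased with `Finset (ZMod 61)`
  does not elaborate in 10 min, HOME gen-28 notes; at the right end `48` the law is automatic: `48 − 16 = 32`);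
* the wrapper in `ℤ₆₁` language (`step3_zmod61`): `j = 1 ∨ j = −1`.

References: M. B. Nathanson, *Additive Number Theory: Inverse Problems*, GTM 165, §2.5 (progressions in `ℤ/pℤ`).
-/

open Finset

namespace Summit.MatrixMultiplication.OmegaCensus.CubeNB

open Literature.Combinatorics.Additive

/-- `61` is prime. [folklore] -/
theorem prime_61 : Nat.Prime 61 := by norm_num

/-! ## Positions in the window `{0,…,n−1} ⊆ ℤ/pℤ` -/

section Positions

variable {p : ℕ} [hp : Fact p.Prime]

/-- In `ℤ/pℤ`, the run `{0, 1, …, n−1}` (`n ≤ p`) is the set of residues of value `< n`. [cite: Nathanson1996, §2.5] -/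
theorem mem_apFinset_zero_one_iff {n : ℕ} (hn : n ≤ p) {x : ZMod p} : x ∈ apFinset (0 : ZMod p) 1 n ↔ x.val < n := by
  rw [mem_apFinset]
  constructor
  · rintro ⟨i, hi, rfl⟩
    rw [zero_add, nsmul_eq_mul, mul_one, ZMod.val_natCast, Nat.mod_eq_of_lt (lt_of_lt_of_le hi hn)]
    exact hi
  · intro hx
    exact ⟨x.val, hx, by rw [zero_add, nsmul_eq_mul, mul_one, ZMod.natCast_zmod_val]⟩

/-- The run `{0,…,n−1}` filtered by `val < c` is the run `{0,…,min(n,c)−1}`; for `c ≤ n ≤ p` it has `c` elements. [cite: Nathanson1996, §2.5] -/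
theorem card_filter_apFinset_zero_one {n c : ℕ} (hn : n ≤ p) (hc : c ≤ n) :
    #((apFinset (0 : ZMod p) 1 n).filter fun y => y.val < c) = c := by
  have h : (apFinset (0 : ZMod p) 1 n).filter (fun y => y.val < c) = apFinset (0 : ZMod p) 1 c := by
    ext y
    rw [Finset.mem_filter, mem_apFinset_zero_one_iff hn, mem_apFinset_zero_one_iff (hc.trans hn)]
    constructor
    · exact fun h => h.2
    · exact fun h => ⟨lt_of_lt_of_le h hc, h⟩
  rw [h, card_apFinset one_ne_zero (hc.trans hn)]

end Positions

/-- Positions of the terms of a progression in `ℤ₆₁`: `(t + i•j).val = (t.val + j.val·i) mod 61`. [folklore] -/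
theorem val_add_nsmul_zmod61 (t j : ZMod 61) (i : ℕ) : (t + i • j).val = (t.val + j.val * i) % 61 := by
  have h : t + i • j = ((t.val + j.val * i : ℕ) : ZMod 61) := by
    push_cast
    rw [ZMod.natCast_zmod_val, ZMod.natCast_zmod_val, nsmul_eq_mul, mul_comm]
  rw [h, ZMod.val_natCast]

/-- `i ↦ t + i•j` is injective on `i < 61` (`j ≠ 0` in `ℤ₆₁`). [folklore] -/
theorem zmod61_natMul_injOn {t j : ZMod 61} (hj : j ≠ 0) {i i' : ℕ} (hi : i < 61) (hi' : i' < 61)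
    (h : t + i • j = t + i' • j) : i = i' := by
  haveI : Fact (Nat.Prime 61) := ⟨prime_61⟩
  have h1 : (i : ZMod 61) * j = (i' : ZMod 61) * j := by
    have := add_left_cancel h; simpa [nsmul_eq_mul] using this
  have h2 : (i : ZMod 61) = (i' : ZMod 61) := mul_right_cancel₀ hj h1
  have h3 := (ZMod.natCast_eq_natCast_iff' i i' 61).1 h2
  rwa [Nat.mod_eq_of_lt hi, Nat.mod_eq_of_lt hi'] at h3

/-! ## The prefix law of a disjoint union of 4-runs -/

section Prefix

/-- **Prefix law.**  In `ℤ₆₁` let `T = ⋃_{k ∈ s} {g k, g k + 1, g k + 2, g k + 3}` be a union of PAIRWISE DISJOINT 4-runs inside the window `{0,…,47}`.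
For every `x ∉ T`, the number of elements of `T` of value `< x.val` is a multiple of `4`: a run with first value `< x.val` lies entirely below
`x` (else it would contain `x`), a run with first value `≥ x.val` entirely at or above. [folklore] -/
theorem four_dvd_card_filter_val_lt {ι : Type*} (s : Finset ι) (g : ι → ZMod 61)
    (hdisj : (s : Set ι).PairwiseDisjoint fun k => apFinset (g k) 1 4)
    (hsub : ∀ k ∈ s, apFinset (g k) 1 4 ⊆ apFinset 0 1 48) (x : ZMod 61)
    (hx : x ∉ s.biUnion fun k => apFinset (g k) 1 4) :
    4 ∣ #((s.biUnion fun k => apFinset (g k) 1 4).filter fun y => y.val < x.val) := by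
  haveI : Fact (Nat.Prime 61) := ⟨prime_61⟩
  rw [Finset.filter_biUnion]
  have hdisj' : (s : Set ι).PairwiseDisjoint fun k => (apFinset (g k) 1 4).filter fun y => y.val < x.val :=
    hdisj.mono fun k => Finset.filter_subset _ _
  rw [Finset.card_biUnion hdisj']
  apply Finset.dvd_sum
  intro k hk
  -- values of the run: (g k).val + i, i < 4, no wrap-around
  have hg48 : (g k).val < 48 :=
    (mem_apFinset_zero_one_iff (by norm_num)).1 (hsub k hk (mem_apFinset.2 ⟨0, by norm_num, by simp⟩))
  have hval : ∀ i, i < 4 → (g k + i • (1 : ZMod 61)).val = (g k).val + i := by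
    intro i hi
    rw [val_add_nsmul_zmod61, ZMod.val_one, one_mul, Nat.mod_eq_of_lt (by omega)]
  by_cases hlt : (g k).val < x.val
  · -- the whole run is below x
    have hall : (apFinset (g k) 1 4).filter (fun y => y.val < x.val) = apFinset (g k) 1 4 := by
      apply Finset.filter_true_of_mem
      intro y hy
      obtain ⟨i, hi, rfl⟩ := mem_apFinset.1 hy
      rw [hval i hi]
      by_contra hge
      rw [not_lt] at hge
      -- then x itself is a term of the run
      obtain ⟨i₀, hi₀⟩ : ∃ i₀, (g k).val + i₀ = x.val := ⟨x.val - (g k).val, by omega⟩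
      have hi₀4 : i₀ < 4 := by omega
      have hxmem : x ∈ apFinset (g k) 1 4 := by
        refine mem_apFinset.2 ⟨i₀, hi₀4, ZMod.val_injective 61 ?_⟩
        rw [hval i₀ hi₀4, hi₀]
      exact hx (Finset.mem_biUnion.2 ⟨k, hk, hxmem⟩)
    rw [hall, card_apFinset one_ne_zero (by norm_num)]
  · -- the whole run is at or above x
    have hnone : (apFinset (g k) 1 4).filter (fun y => y.val < x.val) = ∅ := by
      apply Finset.filter_false_of_mem
      intro y hy
      obtain ⟨i, hi, rfl⟩ := mem_apFinset.1 hy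
      rw [hval i hi]
      omega
    rw [hnone, Finset.card_empty]
    exact dvd_zero 4

/-- **Complement count.**  If `T ⊔ S = {0,…,47}` in `ℤ₆₁` and `x.val ≤ 48`, then `#{y ∈ T : y.val < x.val} = x.val − #{y ∈ S : y.val < x.val}` and
`#{y ∈ S : y.val < x.val} ≤ x.val`. [folklore] -/
theorem card_filter_val_lt_of_union {T S : Finset (ZMod 61)} (hU : T ∪ S = apFinset 0 1 48) (hTS : Disjoint T S)
    {x : ZMod 61} (hx : x.val ≤ 48) :
    #(S.filter fun y => y.val < x.val) ≤ x.val ∧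
      #(T.filter fun y => y.val < x.val) = x.val - #(S.filter fun y => y.val < x.val) := by
  haveI : Fact (Nat.Prime 61) := ⟨prime_61⟩
  have hV : #((apFinset (0 : ZMod 61) 1 48).filter fun y => y.val < x.val) = x.val :=
    card_filter_apFinset_zero_one (by norm_num) hx
  have hsplit : (apFinset (0 : ZMod 61) 1 48).filter (fun y => y.val < x.val) =
      T.filter (fun y => y.val < x.val) ∪ S.filter (fun y => y.val < x.val) := by
    rw [← hU, Finset.filter_union]
  have hdisj : Disjoint (T.filter fun y => y.val < x.val) (S.filter fun y => y.val < x.val) :=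
    Finset.disjoint_filter_filter hTS
  have hsum := Finset.card_union_of_disjoint hdisj
  rw [← hsplit, hV] at hsum
  omega

end Prefix

/-! ## The finite check of Step 3, on `ℕ` -/

section Finite

/-- **The finite check (kernel `decide`).**  For all `j, t < 61`: if the sixteen positions `(t + j·i) mod 61` (`i < 16`) lie in `[0,48)` and at each
of them the prefix law `4 ∣ (t + j·k) mod 61 − #{i < 16 : (t + j·i) mod 61 < (t + j·k) mod 61}` holds, then `j ∈ {0, 1, 60}` — i.e. only the steps
`±1` place a 16-term progression of `ℤ₆₁` inside a 48-window with a complement whose maximal runs all have length `≡ 0 (mod 4)`.  (The weaker law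
«every complementary run has length `≥ 4`» would also admit `j = ±30, ±31`.)  The conclusion is written as a `Finset` membership to keep the
`Decidable` instance small. [folklore] -/
theorem step3_nat : ∀ j < 61, ∀ t < 61, (∀ i < 16, (t + j * i) % 61 < 48) →
    (∀ k < 16, 4 ∣ (t + j * k) % 61 - #((range 16).filter fun i => (t + j * i) % 61 < (t + j * k) % 61)) →
    j ∈ ({0, 1, 60} : Finset ℕ) := by
  decide +kernel

/-- **Step 3 in `ℤ₆₁` language.**  If the 16-term progression `S = {t + i•j : i < 16}` (`j ≠ 0`) lies in the window `{0,…,47}` and the prefix law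
`4 ∣ x.val − #{y ∈ S : y.val < x.val}` holds at every `x ∈ S`, then `j = ±1`. [folklore] -/
theorem step3_zmod61 {t j : ZMod 61} (hj : j ≠ 0) (hSV : apFinset t j 16 ⊆ apFinset 0 1 48)
    (hgap : ∀ x ∈ apFinset t j 16, 4 ∣ x.val - #((apFinset t j 16).filter fun y => y.val < x.val)) : j = 1 ∨ j = -1 := by
  have h60' : ((60 : ℕ) : ZMod 61) = -1 := by decide
  haveI : Fact (Nat.Prime 61) := ⟨prime_61⟩
  -- positions
  have hpos : ∀ i, i < 16 → (t.val + j.val * i) % 61 < 48 := by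
    intro i hi
    rw [← val_add_nsmul_zmod61]
    exact (mem_apFinset_zero_one_iff (by norm_num)).1 (hSV (mem_apFinset.2 ⟨i, hi, rfl⟩))
  -- counts below a value, re-indexed by i < 16
  have hcount : ∀ c : ℕ, #((apFinset t j 16).filter fun y => y.val < c) =
      #((range 16).filter fun i => (t.val + j.val * i) % 61 < c) := by
    intro c
    have himg : apFinset t j 16 = (range 16).image fun i : ℕ => t + i • j := rfl
    rw [himg, Finset.filter_image, Finset.card_image_of_injOn]
    · apply congrArg Finset.card
      apply Finset.filter_congr
      intro i _
      rw [val_add_nsmul_zmod61]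
    · intro i hi i' hi' h
      have hi16 := Finset.mem_range.1 (Finset.mem_filter.1 (Finset.mem_coe.1 hi)).1
      have hi16' := Finset.mem_range.1 (Finset.mem_filter.1 (Finset.mem_coe.1 hi')).1
      exact zmod61_natMul_injOn hj (by omega) (by omega) h
  -- the prefix law, re-indexed
  have hgap' : ∀ k, k < 16 → 4 ∣ (t.val + j.val * k) % 61 -
      #((range 16).filter fun i => (t.val + j.val * i) % 61 < (t.val + j.val * k) % 61) := by
    intro k hk
    have h := hgap (t + k • j) (mem_apFinset.2 ⟨k, hk, rfl⟩)
    rwa [hcount, val_add_nsmul_zmod61] at h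
  -- conclude
  have hmem := step3_nat j.val j.val_lt t.val t.val_lt hpos hgap'
  simp only [Finset.mem_insert, Finset.mem_singleton] at hmem
  rcases hmem with h0 | h1 | h60
  · exact absurd ((ZMod.val_eq_zero j).1 h0) hj
  · left
    have : ((j.val : ℕ) : ZMod 61) = ((1 : ℕ) : ZMod 61) := by rw [h1]
    rwa [ZMod.natCast_zmod_val, Nat.cast_one] at this
  · right
    have : ((j.val : ℕ) : ZMod 61) = ((60 : ℕ) : ZMod 61) := by rw [h60]
    rw [ZMod.natCast_zmod_val] at this
    rw [this, h60']

end Finite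

/-! ## Appendix (gen 29, second clash): general window length, and the finite check for the class `{(3,2,5),(2,4,4)}`

For the sibling orientation class `{(3,2,5),(2,4,4)}` (also N18-tight at block `(2,4,4)`: `15 + 4 + 32 + 2 + 10 = 63`) the window is `{0,…,42}` and the
progression `Y₁ − A₂` has `11` terms; the eight 4-runs are the same.  The complement count is restated for a general window length `n ≤ 61`, the finite
check is run for `(window, terms) = (43, 11)`, and the `ℤ₆₁` wrapper is stated once for every `(n, m)` given the corresponding `ℕ`-table as a hypothesis. -/

section Window

/-- **Complement count, general window.**  If `T ⊔ S = {0,…,n−1}` in `ℤ₆₁` (`n ≤ 61`) and `x.val ≤ n`, then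
`#{y ∈ T : y.val < x.val} = x.val − #{y ∈ S : y.val < x.val}` and `#{y ∈ S : y.val < x.val} ≤ x.val`. [folklore] -/
theorem card_filter_val_lt_of_union_window {n : ℕ} (hn : n ≤ 61) {T S : Finset (ZMod 61)} (hU : T ∪ S = apFinset 0 1 n)
    (hTS : Disjoint T S) {x : ZMod 61} (hx : x.val ≤ n) :
    #(S.filter fun y => y.val < x.val) ≤ x.val ∧
      #(T.filter fun y => y.val < x.val) = x.val - #(S.filter fun y => y.val < x.val) := by
  haveI : Fact (Nat.Prime 61) := ⟨prime_61⟩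
  have hV : #((apFinset (0 : ZMod 61) 1 n).filter fun y => y.val < x.val) = x.val :=
    card_filter_apFinset_zero_one hn hx
  have hsplit : (apFinset (0 : ZMod 61) 1 n).filter (fun y => y.val < x.val) =
      T.filter (fun y => y.val < x.val) ∪ S.filter (fun y => y.val < x.val) := by
    rw [← hU, Finset.filter_union]
  have hdisj : Disjoint (T.filter fun y => y.val < x.val) (S.filter fun y => y.val < x.val) :=
    Finset.disjoint_filter_filter hTS
  have hsum := Finset.card_union_of_disjoint hdisj
  rw [← hsplit, hV] at hsum
  omega

/-- **The finite check for `(window, terms) = (43, 11)` (kernel `decide`).**  For all `j, t < 61`: if the eleven positions `(t + j·i) mod 61` (`i < 11`)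
lie in `[0,43)` and the prefix law holds at each of them, then `j ∈ {0, 1, 60}`. [folklore] -/
theorem step3_nat_43_11 : ∀ j < 61, ∀ t < 61, (∀ i < 11, (t + j * i) % 61 < 43) →
    (∀ k < 11, 4 ∣ (t + j * k) % 61 - #((range 11).filter fun i => (t + j * i) % 61 < (t + j * k) % 61)) →
    j ∈ ({0, 1, 60} : Finset ℕ) := by
  decide +kernel

/-- **Step 3 in `ℤ₆₁` language, general `(n, m)`.**  Given the `ℕ`-table for `(window, terms) = (n, m)` (e.g. `step3_nat`, `step3_nat_43_11`): if the
`m`-term progression `S = {t + i•j : i < m}` (`j ≠ 0`) lies in `{0,…,n−1}` (`n ≤ 61`) and `4 ∣ x.val − #{y ∈ S : y.val < x.val}` at every `x ∈ S`, then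
`j = ±1`. [folklore] -/
theorem step_pm_one_of_nat_table {n m : ℕ} (hn : n ≤ 61) (hm : m ≤ 61)
    (htable : ∀ j < 61, ∀ t < 61, (∀ i < m, (t + j * i) % 61 < n) →
      (∀ k < m, 4 ∣ (t + j * k) % 61 - #((range m).filter fun i => (t + j * i) % 61 < (t + j * k) % 61)) →
      j ∈ ({0, 1, 60} : Finset ℕ))
    {t j : ZMod 61} (hj : j ≠ 0) (hSV : apFinset t j m ⊆ apFinset 0 1 n)
    (hgap : ∀ x ∈ apFinset t j m, 4 ∣ x.val - #((apFinset t j m).filter fun y => y.val < x.val)) : j = 1 ∨ j = -1 := by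
  have h60' : ((60 : ℕ) : ZMod 61) = -1 := by decide
  haveI : Fact (Nat.Prime 61) := ⟨prime_61⟩
  -- positions
  have hpos : ∀ i, i < m → (t.val + j.val * i) % 61 < n := by
    intro i hi
    rw [← val_add_nsmul_zmod61]
    exact (mem_apFinset_zero_one_iff hn).1 (hSV (mem_apFinset.2 ⟨i, hi, rfl⟩))
  -- counts below a value, re-indexed by i < m
  have hcount : ∀ c : ℕ, #((apFinset t j m).filter fun y => y.val < c) =
      #((range m).filter fun i => (t.val + j.val * i) % 61 < c) := by
    intro c
    have himg : apFinset t j m = (range m).image fun i : ℕ => t + i • j := rfl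
    rw [himg, Finset.filter_image, Finset.card_image_of_injOn]
    · apply congrArg Finset.card
      apply Finset.filter_congr
      intro i _
      rw [val_add_nsmul_zmod61]
    · intro i hi i' hi' h
      have him := Finset.mem_range.1 (Finset.mem_filter.1 (Finset.mem_coe.1 hi)).1
      have him' := Finset.mem_range.1 (Finset.mem_filter.1 (Finset.mem_coe.1 hi')).1
      exact zmod61_natMul_injOn hj (by omega) (by omega) h
  -- the prefix law, re-indexed
  have hgap' : ∀ k, k < m → 4 ∣ (t.val + j.val * k) % 61 -
      #((range m).filter fun i => (t.val + j.val * i) % 61 < (t.val + j.val * k) % 61) := by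
    intro k hk
    have h := hgap (t + k • j) (mem_apFinset.2 ⟨k, hk, rfl⟩)
    rwa [hcount, val_add_nsmul_zmod61] at h
  -- conclude
  have hmem := htable j.val j.val_lt t.val t.val_lt hpos hgap'
  simp only [Finset.mem_insert, Finset.mem_singleton] at hmem
  rcases hmem with h0 | h1 | h60
  · exact absurd ((ZMod.val_eq_zero j).1 h0) hj
  · left
    have : ((j.val : ℕ) : ZMod 61) = ((1 : ℕ) : ZMod 61) := by rw [h1]
    rwa [ZMod.natCast_zmod_val, Nat.cast_one] at this
  · right
    have : ((j.val : ℕ) : ZMod 61) = ((60 : ℕ) : ZMod 61) := by rw [h60]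
    rw [ZMod.natCast_zmod_val] at this
    rw [this, h60']

/-- **The finite check for `(window, terms) = (42, 18)` (kernel `decide`)** — the table for the three-block pattern `{(2,2,5),(3,3,2),(3,4,2)}`
(N18-tight at block `(3,4,2)`: `16 + 4 + 24 + 3 + 16 = 63`; window `|V| = 42`, `|Y° − A₃| = 18`, six 4-runs).  For all `j, t < 61`: if the eighteen positions
`(t + j·i) mod 61` (`i < 18`) lie in `[0,42)` and the prefix law holds at each of them, then `j ∈ {0, 1, 60}`. [folklore] -/
theorem step3_nat_42_18 : ∀ j < 61, ∀ t < 61, (∀ i < 18, (t + j * i) % 61 < 42) →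
    (∀ k < 18, 4 ∣ (t + j * k) % 61 - #((range 18).filter fun i => (t + j * i) % 61 < (t + j * k) % 61)) →
    j ∈ ({0, 1, 60} : Finset ℕ) := by
  decide +kernel

end Window

end Summit.MatrixMultiplication.OmegaCensus.CubeNB
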